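import Literature.NumberTheory.GaloisRepresentations.WeilLAdicCharacterLocalShape
import Literature.NumberTheory.GaloisRepresentations.LubinTateReciprocity
import Literature.NumberTheory.GaloisRepresentations.PstWeilDeligneCharacterTwists
import Literature.NumberTheory.GaloisRepresentations.WeilLAdicCharacterDeRham
import HarnessLib

/-!
# Serre's theorem "de Rham above `ℓ`" reduced to its two local inputs

Topic `NumberTheory/GaloisRepresentations`; namespace `Literature.NumberTheory.GaloisRepresentations`.
Proof file (definitions with bodies and theorems; no named fact, no instance, D-0026) towards the named
fact `HeckeCharacter.exists_lAdic_isDeRhamFramed` (`WeilLAdicCharacterDeRham`): the `ℓ`-adic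
character of an algebraic Hecke character is de Rham above `ℓ` (Serre, *Abelian ℓ-adic
representations* (1968), Ch. III §2.3 with §1.2 and App. A5; Conrad 2011 App. B Prop. B.4).

## Main result

`HeckeCharacter.exists_lAdic_isDeRhamFramed_of_local hPU hLT : exists_lAdic_isDeRhamFramed` — the
global statement follows from two LOCAL inputs about Fontaine's datum `fontainePst F ℓ hF` of a
characteristic-`0` local field `F` of residue characteristic `ℓ`:

* (PU) *potentially unramified representations are de Rham*: every `ρ : Γ_F →ₜ* GL_n(ℚ̄_ℓ)` trivial on
  `U ∩ I_F` for an open subgroup `U ≤ Γ_F` is de Rham (Fontaine 1994 Exp. III §5 with Brinon–Conrad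
  2009 Prop. 6.3.8: de Rham is insensitive to finite base change; unramified ⇒ de Rham is the tree's
  `fontainePst …|>.isDeRhamFramed_of_isLocallyUnramified`);
* (LT) *Lubin–Tate characters are de Rham in every embedding*: for every uniformiser `π` of `F` and
  every continuous `e : F → ℚ̄_ℓ`, `1 ⊗ (e ∘ χ_π)` is de Rham (`ltEmbChar`; Serre 1968 Ch. III §A4–A5,
  Conrad 2011 Prop. B.4 — the Hodge–Tate/de Rham periods of Lubin–Tate formal groups, Colmez 1993 §I).

## The assembly (Serre III §2.3, App. A5)

Weil's `r = hinf.weilRep hmod ι` (`WeilLAdicCharacterProofs`) gives clause (i) (`isUnramifiedAt_weilRep`,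
`hasFrobCharpolyAt_weilRep`).  At `v ∣ ℓ`, by the local shape of Weil's character
(`HasInfinityType.weilRep_toAbsGalois_apply`, file `WeilLAdicCharacterLocalShape`: the `ℓ`-adic avatar,
rigidity of idele class characters and the local–global compatibility of the reciprocity map), for `w`
in `W_{K_v}` and THE Artin map `Art = canonicalArtin K_v`,
`r(w)₀₀ = ι⁻¹(χ(⟨Art w⟩_v)) · ∏_{e : K_v → ℚ̄_ℓ} e(Art w)^{-n_e}`; on inertia `Art w = χ_π(w)`
(`coe_lubinTateChar_toAbsGalois_canonicalArtin`, file `LubinTateReciprocity`), and the first factor is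
`1` as soon as `Art w ∈ V_{v,e_v} = {u : |u|=1, |u-1| ≤ |ϖ|^{e_v}}` for a modulus of definition `(T, e)`
of `χ` (`IsModulus.map_localUnits_eq_one_of_mem_congrUnits`).  Hence
`r_v ⊗ (∏_e (e ∘ χ_π)^{-n_e})⁻¹` is trivial on the open subgroup `χ_π⁻¹(V_{v,e_v})` met with `I_v`, so it
is de Rham by (PU); `∏_e (e∘χ_π)^{-n_e}` is de Rham by (LT) and the twist lemmas
(`PstWeilDeligneCharacterTwists`), whence `r_v` is de Rham
(`PstWeilDeligneData.isDeRhamFramed_of_inertia_eq_mul_prod_emb`).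

## References

* [SerreAbelianLadic1968] J.-P. Serre, *Abelian ℓ-adic representations and elliptic curves* (1968),
  Ch. III §1.2, §2.3 (Thm. 2 and its Corollary), App. A4–A5.
* [Conrad2011LiftingGlobal] B. Conrad, *Lifting global representations with local properties* (2011),
  App. B, Prop. B.4.
* [FontaineAsterisque223III] J.-M. Fontaine, Astérisque 223 (1994), Exp. III §1.5, §5.
* [BrinonConrad2009] O. Brinon, B. Conrad, *CMI notes on p-adic Hodge theory* (2009), Prop. 6.3.8.
* [LubinTate1965] J. Lubin, J. Tate, *Formal complex multiplication in local fields*, Ann. Math. 81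
  (1965), Thm. 3.
-/

noncomputable section

open scoped NumberField Topology Polynomial
open NumberField IsDedekindDomain IsDedekindDomain.HeightOneSpectrum Filter

namespace Literature.NumberTheory.GaloisRepresentations

variable {K : Type} [Field K] [NumberField K] {ℓ : ℕ} [Fact ℓ.Prime]

/-! ### §5. Assembly: de Rham above `ℓ`, given the two local inputs -/

section LocalAssembly

open ValuativeRel IsLocalRing Field IsNonarchimedeanLocalField LubinTate PstWeilDeligneData
open Literature.NumberTheory.PAdicHodge

variable {F : Type} [Field F] [ValuativeRel F] [TopologicalSpace F] [IsNonarchimedeanLocalField F]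

-- the normed-field instances on `F` of `LubinTateTorsion.lean` (as in `LubinTateReciprocity`)
attribute [local instance] instUniformSpace_literature rk1 nF nE

/-- **The Lubin–Tate character pushed into `ℚ̄_ℓ` along `e : F → ℚ̄_ℓ`**: `e ∘ χ_π : Γ_F →ₜ* ℚ̄_ℓˣ`.
[cite: SerreAbelianLadic1968, Ch. III §A4] -/
def ltEmbChar {π : 𝒪[F]} (hπ : (valuation F).IsUniformizer (π : F)) (e : F →+* PadicAlgCl ℓ) (he : Continuous e) :
    absoluteGaloisGroup F →ₜ* (PadicAlgCl ℓ)ˣ :=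
  ContinuousMonoidHom.comp ⟨Units.map (e : F →* PadicAlgCl ℓ), Continuous.units_map _ he⟩
    (ContinuousMonoidHom.comp
      ⟨Units.map ((𝒪[F]).subtype : 𝒪[F] →* F), Continuous.units_map ((𝒪[F]).subtype : 𝒪[F] →* F) continuous_subtype_val⟩
      (lubinTateCharacter hπ))

/-- Unfolding: `(e ∘ χ_π)(σ) = e(χ_π(σ))`. [folklore] -/
@[simp] theorem coe_ltEmbChar_apply {π : 𝒪[F]} (hπ : (valuation F).IsUniformizer (π : F)) (e : F →+* PadicAlgCl ℓ)
    (he : Continuous e) (σ : absoluteGaloisGroup F) :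
    (ltEmbChar hπ e he σ : PadicAlgCl ℓ) = e (((lubinTateChar hπ σ : 𝒪[F]ˣ) : 𝒪[F]) : F) := rfl

/-- The Lubin–Tate character with values in `Fˣ`, `σ ↦ χ_π(σ) ∈ 𝒪_Fˣ ⊆ Fˣ`. [folklore] -/
def ltUnitsChar {π : 𝒪[F]} (hπ : (valuation F).IsUniformizer (π : F)) : absoluteGaloisGroup F →ₜ* Fˣ :=
  ContinuousMonoidHom.comp
    ⟨Units.map ((𝒪[F]).subtype : 𝒪[F] →* F), Continuous.units_map ((𝒪[F]).subtype : 𝒪[F] →* F) continuous_subtype_val⟩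
    (lubinTateCharacter hπ)

/-- Unfolding. [folklore] -/
@[simp] theorem coe_ltUnitsChar_apply {π : 𝒪[F]} (hπ : (valuation F).IsUniformizer (π : F)) (σ : absoluteGaloisGroup F) :
    (ltUnitsChar hπ σ : F) = (((lubinTateChar hπ σ : 𝒪[F]ˣ) : 𝒪[F]) : F) := rfl

/-- **`χ_π = Art_F` on inertia**, units form: for `σ ∈ I_F`, `χ_π(σ) = Art_F(w_σ)` where `w_σ` is `σ`
as an element of the Weil group. [cite: LubinTate1965, Thm. 3] -/
theorem ltUnitsChar_eq_canonicalArtin [CharZero F] {π : 𝒪[F]} (hπ : (valuation F).IsUniformizer (π : F))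
    {w : WeilGroup F} (hw : w ∈ WeilGroup.inertia F) :
    ltUnitsChar hπ (WeilGroup.toAbsGalois F w) = canonicalArtin F w :=
  Units.ext (by rw [coe_ltUnitsChar_apply]; exact coe_lubinTateChar_toAbsGalois_canonicalArtin hπ hw)

/-- **Local assembly.**  Let `ρ : Γ_F →ₜ* GL₁(ℚ̄_ℓ)` be such that, for `w` in the inertia subgroup of
`W_F`, `ρ(w)₀₀ = g(w) · ∏_{i ∈ s} e_i(Art_F w)^{k_i}` with continuous embeddings `e_i : F → ℚ̄_ℓ` and a
factor `g` which is `1` as soon as `Art_F(w)` lies in some open subgroup `V ≤ Fˣ`.  If potentially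
unramified representations and the Lubin–Tate characters `e_i ∘ χ_π` are de Rham for `𝔇`, then `ρ` is
de Rham for `𝔇`: `ρ ⊗ (∏ (e_i ∘ χ_π)^{k_i})⁻¹` is trivial on `χ_π⁻¹(V) ∩ I_F` (`χ_π = Art_F` on inertia).
[cite: SerreAbelianLadic1968, Ch. III §A5] -/
theorem PstWeilDeligneData.isDeRhamFramed_of_inertia_eq_mul_prod_emb [CharZero F] (𝔇 : PstWeilDeligneData F ℓ)
    {π : 𝒪[F]} (hπ : (valuation F).IsUniformizer (π : F))
    (hPU : ∀ (n : ℕ) (ρ : FramedRep (absoluteGaloisGroup F) (PadicAlgCl ℓ) n) (U : Subgroup (absoluteGaloisGroup F)),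
      IsOpen (U : Set (absoluteGaloisGroup F)) → (∀ σ ∈ U, σ ∈ absInertia F → ρ σ = 1) → 𝔇.IsDeRhamFramed ρ)
    {ι' : Type*} (s : Finset ι') (emb : ι' → (F →+* PadicAlgCl ℓ)) (hemb : ∀ i, Continuous (emb i)) (k : ι' → ℤ)
    (hLT : ∀ i ∈ s, 𝔇.IsDeRhamFramed
      ((1 : FramedRep (absoluteGaloisGroup F) (PadicAlgCl ℓ) 1).twist (ltEmbChar hπ (emb i) (hemb i))))
    (ρ : FramedRep (absoluteGaloisGroup F) (PadicAlgCl ℓ) 1) (g : WeilGroup F → PadicAlgCl ℓ)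
    (V : Subgroup Fˣ) (hV : IsOpen (V : Set Fˣ))
    (hg : ∀ w ∈ WeilGroup.inertia F, canonicalArtin F w ∈ V → g w = 1)
    (hρ : ∀ w ∈ WeilGroup.inertia F,
      ((ρ (WeilGroup.toAbsGalois F w) : GL (Fin 1) (PadicAlgCl ℓ)) : Matrix (Fin 1) (Fin 1) (PadicAlgCl ℓ)) 0 0 =
        g w * ∏ i ∈ s, emb i ((canonicalArtin F w : Fˣ) : F) ^ k i) :
    𝔇.IsDeRhamFramed ρ := by
  -- the algebraic part
  set ε : absoluteGaloisGroup F →ₜ* (PadicAlgCl ℓ)ˣ := ∏ i ∈ s, ltEmbChar hπ (emb i) (hemb i) ^ k i with hε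
  have hεdR : 𝔇.IsDeRhamFramed ((1 : FramedRep (absoluteGaloisGroup F) (PadicAlgCl ℓ) 1).twist ε) :=
    𝔇.isDeRhamFramed_one_twist_finset_prod s _ fun i hi => (hLT i hi).one_twist_zpow (k i)
  have hεval : ∀ σ, (ε σ : PadicAlgCl ℓ) = ∏ i ∈ s, emb i ((ltUnitsChar hπ σ : Fˣ) : F) ^ k i := by
    intro σ
    rw [hε, ContinuousMonoidHom.finset_prod_apply', Units.coe_prod]
    refine Finset.prod_congr rfl fun i _ => ?_
    rw [ContinuousMonoidHom.zpow_apply', Units.val_zpow_eq_zpow_val, coe_ltEmbChar_apply, coe_ltUnitsChar_apply]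
  -- the open subgroup `U = χ_π⁻¹(V)`
  set U : Subgroup (absoluteGaloisGroup F) := V.comap (ltUnitsChar hπ).toMonoidHom with hU
  have hUopen : IsOpen (U : Set (absoluteGaloisGroup F)) := hV.preimage (ltUnitsChar hπ).continuous
  -- `ρ ⊗ ε⁻¹` is trivial on `U ∩ I_F`
  have htriv : ∀ σ ∈ U, σ ∈ absInertia F → (ρ.twist ε⁻¹) σ = 1 := by
    intro σ hσU hσI
    set w : WeilGroup F := WeilGroup.mk σ ⟨0, isFrobPow_zero_iff_mem_absInertia.mpr hσI⟩ with hw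
    have hwσ : WeilGroup.toAbsGalois F w = σ := WeilGroup.toAbsGalois_mk _ _
    have hwI : w ∈ WeilGroup.inertia F := by rw [WeilGroup.mem_inertia_iff, hwσ]; exact hσI
    have hart : ltUnitsChar hπ σ = canonicalArtin F w := by rw [← hwσ]; exact ltUnitsChar_eq_canonicalArtin hπ hwI
    have hgw : g w = 1 := hg w hwI (by rw [← hart]; exact hσU)
    have h00 : ((ρ σ : GL (Fin 1) (PadicAlgCl ℓ)) : Matrix (Fin 1) (Fin 1) (PadicAlgCl ℓ)) 0 0 = (ε σ : PadicAlgCl ℓ) := by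
      rw [← hwσ, hρ w hwI, hgw, one_mul, hεval, hwσ, hart]
    ext i j
    rw [Subsingleton.elim i 0, Subsingleton.elim j 0, FramedRep.coe_twist_apply, Matrix.smul_apply, h00,
      smul_eq_mul, Units.val_one, Matrix.one_apply_eq]
    change ((ε⁻¹ σ : (PadicAlgCl ℓ)ˣ) : PadicAlgCl ℓ) * (ε σ : PadicAlgCl ℓ) = 1
    rw [show ε⁻¹ σ = (ε σ)⁻¹ from rfl, Units.inv_mul]
  have hdR' : 𝔇.IsDeRhamFramed (ρ.twist ε⁻¹) := hPU 1 _ U hUopen htriv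
  have h := hdR'.twist_det hεdR
  rwa [FramedRep.det_one_twist, FramedRep.twist_twist, mul_inv_cancel, FramedRep.twist_one] at h

end LocalAssembly

namespace HeckeCharacter

open PadicEmbedding PstWeilDeligneData ValuativeRel
open Literature.NumberTheory.PAdicHodge

/-- The subgroup `V_{v,m} = {u ∈ K_vˣ : |u|_v = 1, |u - 1|_v ≤ |ϖ_v|^m}` of `K_vˣ`. [folklore] -/
def congrUnits (v : HeightOneSpectrum (𝓞 K)) (m : ℕ) : Subgroup (v.adicCompletion K)ˣ where
  carrier := {u | Valued.v (u : v.adicCompletion K) = 1 ∧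
    Valued.v ((u : v.adicCompletion K) - 1) ≤ WithZero.exp (-(m : ℤ))}
  one_mem' := by simp
  mul_mem' {a b} ha hb := by
    refine ⟨by rw [Units.val_mul, map_mul, ha.1, hb.1, mul_one], ?_⟩
    rcases Nat.eq_zero_or_pos m with hm | hm
    · subst hm
      have hab : Valued.v ((a * b : (v.adicCompletion K)ˣ) : v.adicCompletion K) = 1 := by
        rw [Units.val_mul, map_mul, ha.1, hb.1, mul_one]
      calc Valued.v (((a * b : (v.adicCompletion K)ˣ) : v.adicCompletion K) - 1)
          ≤ max (Valued.v ((a * b : (v.adicCompletion K)ˣ) : v.adicCompletion K)) (Valued.v (1 : v.adicCompletion K)) :=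
            Valuation.map_sub _ _ _
        _ = WithZero.exp (-((0 : ℕ) : ℤ)) := by rw [hab, map_one, max_self]; rfl
    · rw [Units.val_mul]
      exact valued_mul_sub_one_le ha.2 hb.2 (by
        rw [← WithZero.exp_zero, WithZero.exp_lt_exp]; omega)
  inv_mem' {a} ha := by
    refine ⟨by rw [Units.val_inv_eq_inv_val, map_inv₀, ha.1, inv_one], ?_⟩
    rcases Nat.eq_zero_or_pos m with hm | hm
    · subst hm
      have hai : Valued.v ((a⁻¹ : (v.adicCompletion K)ˣ) : v.adicCompletion K) = 1 := by
        rw [Units.val_inv_eq_inv_val, map_inv₀, ha.1, inv_one]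
      calc Valued.v (((a⁻¹ : (v.adicCompletion K)ˣ) : v.adicCompletion K) - 1)
          ≤ max (Valued.v ((a⁻¹ : (v.adicCompletion K)ˣ) : v.adicCompletion K)) (Valued.v (1 : v.adicCompletion K)) :=
            Valuation.map_sub _ _ _
        _ = WithZero.exp (-((0 : ℕ) : ℤ)) := by rw [hai, map_one, max_self]; rfl
    · rw [Units.val_inv_eq_inv_val]
      exact valued_inv_sub_one_le ha.2 (by rw [← WithZero.exp_zero, WithZero.exp_lt_exp]; omega)

/-- Membership in `congrUnits`. [folklore] -/
theorem mem_congrUnits_iff {v : HeightOneSpectrum (𝓞 K)} {m : ℕ} {u : (v.adicCompletion K)ˣ} :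
    u ∈ congrUnits v m ↔ Valued.v (u : v.adicCompletion K) = 1 ∧
      Valued.v ((u : v.adicCompletion K) - 1) ≤ WithZero.exp (-(m : ℤ)) := Iff.rfl

/-- `congrUnits v m` is open in `K_vˣ`. [folklore] -/
theorem isOpen_congrUnits (v : HeightOneSpectrum (𝓞 K)) (m : ℕ) : IsOpen (congrUnits v m : Set (v.adicCompletion K)ˣ) := by
  -- `{|x| = 1} = {|x| ≤ 1} ∖ {|x| < 1}` is open
  have h1 : IsOpen {x : v.adicCompletion K | Valued.v x = 1} := by
    have hle : IsOpen {x : v.adicCompletion K | Valued.v x ≤ Valued.v (1 : v.adicCompletion K)} := by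
      simpa only [Valuation.restrict_le_iff] using
        Valued.isOpen_closedBall (v.adicCompletion K) (r := Valued.v.restrict (1 : v.adicCompletion K))
          (by rw [Valuation.map_one]; exact one_ne_zero)
    have hlt : IsClosed {x : v.adicCompletion K | Valued.v x < Valued.v (1 : v.adicCompletion K)} := by
      simpa only [Valuation.restrict_lt_iff] using
        (Valued.isClopen_ball (v.adicCompletion K) (Valued.v.restrict (1 : v.adicCompletion K))).isClosed
    have heq : {x : v.adicCompletion K | Valued.v x = 1} =
        {x | Valued.v x ≤ Valued.v (1 : v.adicCompletion K)} ∩ {x | Valued.v x < Valued.v (1 : v.adicCompletion K)}ᶜ := by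
      ext x
      simp only [Set.mem_setOf_eq, Set.mem_inter_iff, Set.mem_compl_iff, map_one, not_lt]
      exact ⟨fun h => ⟨h.le, h.ge⟩, fun h => le_antisymm h.1 h.2⟩
    rw [heq]
    exact hle.inter hlt.isOpen_compl
  -- `{|x - 1| ≤ |ϖ^m|}` is open
  have h2 : IsOpen {x : v.adicCompletion K | Valued.v (x - 1) ≤ WithZero.exp (-(m : ℤ))} := by
    set z : v.adicCompletion K := ((uniformizer K v : (v.adicCompletion K)ˣ) : v.adicCompletion K) ^ m with hzdef
    have hz : Valued.v z = WithZero.exp (-(m : ℤ)) := by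
      rw [hzdef, map_pow, valued_uniformizer, ← WithZero.exp_nsmul]
      congr 1
      simp
    have hz0 : Valued.v.restrict z ≠ 0 :=
      (Valuation.ne_zero_iff _).mpr (pow_ne_zero _ (uniformizer K v).ne_zero)
    have hc : IsOpen {y : v.adicCompletion K | Valued.v y ≤ Valued.v z} := by
      simpa only [Valuation.restrict_le_iff] using Valued.isOpen_closedBall (v.adicCompletion K) hz0
    rw [← hz]
    exact hc.preimage (continuous_id.sub continuous_const)
  exact (h1.inter h2).preimage Units.continuous_val

/-- **A modulus of definition kills `V_{v,e_v}`**: `χ(⟨u⟩_v) = 1` for `u ∈ V_{v,e_v}`. [folklore] -/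
theorem IsModulus.map_localUnits_eq_one_of_mem_congrUnits {χ : HeckeCharacter K}
    {T : Finset (HeightOneSpectrum (𝓞 K))} {e : HeightOneSpectrum (𝓞 K) → ℕ} (hmod : IsModulus χ T e)
    {v : HeightOneSpectrum (𝓞 K)} {u : (v.adicCompletion K)ˣ} (hu : u ∈ congrUnits v (e v)) :
    χ (localUnits v u) = 1 := by
  refine hmod (localUnits v u) (localUnits_fst v u) (fun w => ?_) (fun w _ => ?_)
  · by_cases hw : w = v
    · subst hw; rw [localUnits_snd_apply_self]; exact hu.1
    · rw [localUnits_snd_apply_of_ne u hw, map_one]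
  · by_cases hw : w = v
    · subst hw; rw [localUnits_snd_apply_self]; exact hu.2
    · rw [localUnits_snd_apply_of_ne u hw, sub_self, map_zero]; exact zero_le

/-- **Serre's theorem, assembled from the local inputs.**  Suppose
(PU) *potentially unramified framed representations are de Rham for Fontaine's datum*: for every
characteristic-`0` local field `F` of residue characteristic `ℓ`, every `ρ : Γ_F →ₜ* GL_n(ℚ̄_ℓ)` trivial
on `U ∩ I_F` for an open subgroup `U ≤ Γ_F` is de Rham for `fontainePst F ℓ hF`
(Fontaine 1994 Exp. III §5 with Brinon–Conrad 2009 Prop. 6.3.8; Serre 1968 Ch. III App. A), and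
(LT) *Lubin–Tate characters are de Rham in every embedding*: for every such `F`, uniformiser `π` and
continuous `e : F → ℚ̄_ℓ`, `1 ⊗ (e ∘ χ_π)` is de Rham for `fontainePst F ℓ hF`
(Serre 1968 Ch. III §A4–A5; Conrad 2011 App. B Prop. B.4).
Then the `ℓ`-adic character of every algebraic Hecke character is de Rham above `ℓ`
(`exists_lAdic_isDeRhamFramed`): Weil's `r` (`IsAlgebraic.exists_lAdic`) satisfies clause (i), and at
`v ∣ ℓ`, on the inertia of `W_{K_v}`, `r(w)₀₀ = ι⁻¹(χ(⟨Art w⟩_v)) · ∏_e e(Art w)^{-n_e}`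
(`weilRep_toAbsGalois_apply`), the first factor being `1` when `Art w ∈ V_{v,e_v}` (modulus of definition);
conclude by `isDeRhamFramed_of_inertia_eq_mul_prod_emb`. [cite: SerreAbelianLadic1968, Ch. III §2.3 and App. A5] -/
theorem exists_lAdic_isDeRhamFramed_of_local
    (hPU : ∀ (F : Type) [Field F] [ValuativeRel F] [TopologicalSpace F] [IsNonarchimedeanLocalField F]
      [CharZero F] (ℓ : ℕ) [Fact ℓ.Prime] (hF : valuation F (ℓ : F) < 1) (n : ℕ)
      (ρ : FramedRep (Field.absoluteGaloisGroup F) (PadicAlgCl ℓ) n) (U : Subgroup (Field.absoluteGaloisGroup F)),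
      IsOpen (U : Set (Field.absoluteGaloisGroup F)) → (∀ σ ∈ U, σ ∈ absInertia F → ρ σ = 1) →
        (fontainePst F ℓ hF).IsDeRhamFramed ρ)
    (hLT : ∀ (F : Type) [Field F] [ValuativeRel F] [TopologicalSpace F] [IsNonarchimedeanLocalField F]
      [CharZero F] (ℓ : ℕ) [Fact ℓ.Prime] (hF : valuation F (ℓ : F) < 1) (π : 𝒪[F])
      (hπ : (valuation F).IsUniformizer (π : F)) (e : F →+* PadicAlgCl ℓ) (he : Continuous e),
        (fontainePst F ℓ hF).IsDeRhamFramed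
          ((1 : FramedRep (Field.absoluteGaloisGroup F) (PadicAlgCl ℓ) 1).twist (ltEmbChar hπ e he))) :
    exists_lAdic_isDeRhamFramed := by
  intro K _ _ ℓ _ χ halg ι
  obtain ⟨p, q, hinf⟩ := χ.isAlgebraic_iff_exists_hasInfinityType.mp halg
  obtain ⟨e, hmod⟩ := χ.exists_isModulus_of_ramified
  have hT : ∀ w, w ∉ (finite_ramifiedPlaces_holds χ).toFinset → χ.IsUnramifiedAt w := fun w hw => by
    by_contra h
    exact hw ((finite_ramifiedPlaces_holds χ).mem_toFinset.mpr h)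
  refine ⟨hinf.weilRep hmod ι, fun v hvℓ hv => ?_, fun v hv => ?_⟩
  · have hvT : v ∉ (finite_ramifiedPlaces_holds χ).toFinset := fun h =>
      ((finite_ramifiedPlaces_holds χ).mem_toFinset.mp h) hv
    exact ⟨hinf.isUnramifiedAt_weilRep hmod ι hvT hvℓ, hinf.hasFrobCharpolyAt_weilRep hmod ι hvT hvℓ⟩
  -- the place `v ∣ ℓ`
  haveI := LocalField.charZero_adicCompletion v
  have hF := LocalField.valuation_adicCompletion_natCast_lt_one v ℓ hv
  change (fontainePst (v.adicCompletion K) ℓ hF).IsDeRhamFramed _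
  obtain ⟨π, hπ⟩ := Valuation.exists_isUniformizer_of_isCyclic_of_nontrivial (valuation (v.adicCompletion K))
  classical
  refine PstWeilDeligneData.isDeRhamFramed_of_inertia_eq_mul_prod_emb (fontainePst (v.adicCompletion K) ℓ hF) hπ
    (fun n ρ U hU hρ => hPU (v.adicCompletion K) ℓ hF n ρ U hU hρ)
    (Finset.univ : Finset {f : v.adicCompletion K →+* PadicAlgCl ℓ // Continuous f}) (fun f => f.1) (fun f => f.2)
    (fun f => -embExponent p q ((ι : PadicAlgCl ℓ →+* ℂ).comp (f.1.comp (algebraMap K (v.adicCompletion K)))))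
    (fun f _ => hLT (v.adicCompletion K) ℓ hF π hπ f.1 f.2)
    ((hinf.weilRep hmod ι).toLocal v) (fun w => ι.symm (χ (localUnits v (canonicalArtin (v.adicCompletion K) w)) : ℂ))
    (congrUnits v (e v)) (isOpen_congrUnits v (e v)) (fun w _ hw => ?_) (fun w _ => ?_)
  · rw [hmod.map_localUnits_eq_one_of_mem_congrUnits hw, Units.val_one, map_one]
  · rw [FramedGaloisRep.toLocal_apply]
    exact hinf.weilRep_toAbsGalois_apply hmod ι hT hv (canonicalArtin (v.adicCompletion K))
      (isLocalArtinMap_canonicalArtin_holds (v.adicCompletion K)) w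

end HeckeCharacter

end Literature.NumberTheory.GaloisRepresentations

end
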